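import Mathlib
import HarnessLib

/-!
# Few moduli have many small prime factors (Polymath 8a, Lemma 5.2)

Topic `Literature/NumberTheory/Sieve`, grouping namespace `Polymath8a`; a support file for the named
fact `Literature.NumberTheory.Sieve.mpz_of_lt` (**parity.S29**).  Source: D. H. J. Polymath,
*New equidistribution estimates of Zhang type*, arXiv:1402.0811, §5.3, (5.13)–(5.14) and
**Lemma 5.2**: with `D₀ := exp(log^{1/3} x)` and `𝓔(D)` the set of `d ∈ [D, 2D]` with
`∏_{p∣d, p≤D₀} p > exp(log^{2/3} x)`, "For any fixed `A > 0`, and `D` obeying (5.12), we have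
`|𝓔(D)| ≪ D log^{-A} x`.  *Proof.* If `d ≥ 1` satisfies (5.14), then `∏_{p∣d, p≤D₀} p > exp(log^{2/3} x)
= D₀^{log^{1/3} x}`. In particular, `d` has at least `log^{1/3} x` prime factors, and therefore
`τ(d) ≥ 2^{log^{1/3} x}`. On the other hand, we have `∑_{D≤d≤2D, τ(d)≥κ} 1 ≤ κ⁻¹ ∑_{D≤d≤2D} τ(d) ≪ (D/κ) log x`
… by the standard bound `∑_{D≤d≤2D} τ(d) ≪ D log x`, and the result follows."  This is the first step
of the dispersion argument (§5.3: the exceptional moduli are removed by Corollary 5.3 before the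
factorisation `d = qr`).

We PROVE the lemma in an explicit, `x`-free form (take `D₀ = exp(log^{1/3} x)`, `K = ⌊log^{1/3} x⌋`):

* `Polymath8a.card_primeFactors_gt_of_prod_gt` — if `∏_{p ∣ d, p ≤ D₀} p > D₀^K` then `d` has more
  than `K` prime factors `≤ D₀`;
* `Polymath8a.two_pow_card_primeFactors_le_card_divisors` — `2^{ω(d)} ≤ τ(d)`;
* `Polymath8a.sum_card_divisors_le'` — `∑_{1 ≤ d ≤ Z} τ(d) ≤ Z(1 + log Z)` (the standard bound, re-proved
  here to keep the import closure light);
* `Polymath8a.card_exceptionalModuli_le` — **Lemma 5.2, explicit**: for `D₀ ≥ 1`, `K, D ∈ ℕ`,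
  `#{d ∈ [D, 2D] : ∏_{p∣d, p≤D₀} p > D₀^K} ≤ 2^{-(K+1)} · 2D (1 + log(2D))`.

Everything is PROVED (theorems only; no definitions, no named facts).

## References

* D. H. J. Polymath, arXiv:1402.0811: §5.3, (5.13), (5.14), Lemma 5.2 and its proof; (1.4).
  [cite: Polymath8a2014, Lemma 5.2]
-/

open Finset Real

namespace Literature.NumberTheory.Sieve

namespace Polymath8a

/-- **Many small prime factors**: if `∏_{p ∣ d, p ≤ D₀} p > D₀^K` (`D₀ ≥ 1`) then `d` has more than `K`
prime factors `≤ D₀` ("`d` has at least `log^{1/3} x` prime factors").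
[cite: Polymath8a2014, Lemma 5.2, proof] -/
theorem card_primeFactors_gt_of_prod_gt {D₀ : ℝ} (hD₀ : 1 ≤ D₀) {K d : ℕ}
    (h : D₀ ^ K < ∏ p ∈ d.primeFactors.filter (fun p : ℕ => (p : ℝ) ≤ D₀), (p : ℝ)) :
    K < (d.primeFactors.filter (fun p : ℕ => (p : ℝ) ≤ D₀)).card := by
  by_contra hK
  push Not at hK
  have hle : ∏ p ∈ d.primeFactors.filter (fun p : ℕ => (p : ℝ) ≤ D₀), (p : ℝ) ≤
      D₀ ^ (d.primeFactors.filter (fun p : ℕ => (p : ℝ) ≤ D₀)).card := by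
    rw [← Finset.prod_const]
    exact Finset.prod_le_prod (fun p _ => Nat.cast_nonneg p) fun p hp => (Finset.mem_filter.mp hp).2
  have hpow : D₀ ^ (d.primeFactors.filter (fun p : ℕ => (p : ℝ) ≤ D₀)).card ≤ D₀ ^ K :=
    pow_le_pow_right₀ hD₀ hK
  linarith

/-- **`2^{ω(d)} ≤ τ(d)`** for `d ≠ 0`: the squarefree divisors `∏_{p ∈ S} p`, `S ⊆` prime factors, are
distinct. [folklore] -/
theorem two_pow_card_primeFactors_le_card_divisors {d : ℕ} (hd : d ≠ 0) :
    2 ^ d.primeFactors.card ≤ d.divisors.card := by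
  classical
  -- the injection `S ↦ ∏_{p ∈ S} p` from subsets of the prime factors into the divisors
  have hinj : Set.InjOn (fun S : Finset ℕ => ∏ p ∈ S, p) (d.primeFactors.powerset : Set (Finset ℕ)) := by
    intro S hS T hT hST
    simp only [Finset.coe_powerset, Set.mem_preimage, Set.mem_powerset_iff, Finset.coe_subset] at hS hT
    have hSp : ∀ p ∈ S, p.Prime := fun p hp => Nat.prime_of_mem_primeFactors (hS hp)
    have hTp : ∀ p ∈ T, p.Prime := fun p hp => Nat.prime_of_mem_primeFactors (hT hp)
    have := congrArg Nat.primeFactors hST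
    simp only at this
    rwa [Nat.primeFactors_prod hSp, Nat.primeFactors_prod hTp] at this
  have hmaps : ∀ S ∈ d.primeFactors.powerset, (∏ p ∈ S, p) ∈ d.divisors := by
    intro S hS
    rw [Finset.mem_powerset] at hS
    rw [Nat.mem_divisors]
    refine ⟨?_, hd⟩
    exact (Finset.prod_dvd_prod_of_subset _ _ _ hS).trans
      (Nat.prod_primeFactors_dvd d)
  calc 2 ^ d.primeFactors.card = d.primeFactors.powerset.card := (Finset.card_powerset _).symm
    _ ≤ d.divisors.card := Finset.card_le_card_of_injOn _ hmaps hinj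

/-- **`∑_{1 ≤ d ≤ Z} τ(d) ≤ Z(1 + log Z)`** (the "standard bound" (1.4); re-proved here with a light
import closure). [cite: Polymath8a2014, (1.4)] -/
theorem sum_card_divisors_le' (Z : ℕ) :
    ∑ m ∈ Finset.Icc 1 Z, ((Nat.divisors m).card : ℝ) ≤ Z * (1 + Real.log Z) := by
  have hI : ∀ n : ℕ, Finset.Icc 1 n = Finset.Ioc 0 n := fun n => by
    ext m; simp only [Finset.mem_Ioc, Finset.mem_Icc]; omega
  have h1 : ∑ m ∈ Finset.Icc 1 Z, ((Nat.divisors m).card : ℝ) =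
      ∑ m ∈ Finset.Icc 1 Z, ∑ d ∈ Finset.Icc 1 Z, (if d ∣ m then (1 : ℝ) else 0) := by
    refine Finset.sum_congr rfl fun m hm => ?_
    rw [Finset.mem_Icc] at hm
    rw [← Finset.sum_filter, Finset.sum_const, nsmul_eq_mul, mul_one]
    congr 1
    congr 1
    ext d
    simp only [Nat.mem_divisors, Finset.mem_filter, Finset.mem_Icc]
    constructor
    · rintro ⟨hdvd, hm0⟩
      exact ⟨⟨Nat.pos_of_dvd_of_pos hdvd (by omega), (Nat.le_of_dvd (by omega) hdvd).trans hm.2⟩, hdvd⟩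
    · rintro ⟨⟨-, -⟩, hdvd⟩
      exact ⟨hdvd, by omega⟩
  rw [h1, Finset.sum_comm]
  have h2 : ∀ d ∈ Finset.Icc 1 Z, ∑ m ∈ Finset.Icc 1 Z, (if d ∣ m then (1 : ℝ) else 0) ≤ (Z : ℝ) * (d : ℝ)⁻¹ := by
    intro d hd
    rw [Finset.mem_Icc] at hd
    rw [← Finset.sum_filter, Finset.sum_const, nsmul_eq_mul, mul_one, hI,
      Nat.Ioc_filter_dvd_card_eq_div, ← div_eq_mul_inv]
    exact Nat.cast_div_le
  refine (Finset.sum_le_sum h2).trans ?_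
  rw [← Finset.mul_sum]
  have h3 : ∑ d ∈ Finset.Icc 1 Z, (d : ℝ)⁻¹ = ((harmonic Z : ℚ) : ℝ) := by
    rw [harmonic_eq_sum_Icc]; push_cast; rfl
  rw [h3]
  exact mul_le_mul_of_nonneg_left (harmonic_le_one_add_log Z) (Nat.cast_nonneg Z)

/-- **Polymath 8a, Lemma 5.2 (explicit form)**: for `D₀ ≥ 1` and natural numbers `K, D`,
`#{d ∈ [D, 2D] : ∏_{p ∣ d, p ≤ D₀} p > D₀^K} ≤ 2^{-(K+1)} · 2D(1 + log(2D))`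
(each such `d` has `τ(d) ≥ 2^{K+1}`, and `∑_{d ≤ 2D} τ(d) ≤ 2D(1 + log 2D)`; with `D₀ = exp(log^{1/3} x)`,
`K = ⌊log^{1/3} x⌋` this is the printed `|𝓔(D)| ≪ D log^{-A} x`).
[cite: Polymath8a2014, Lemma 5.2] -/
theorem card_exceptionalModuli_le {D₀ : ℝ} (hD₀ : 1 ≤ D₀) (K D : ℕ) :
    (((Finset.Icc D (2 * D)).filter fun d : ℕ =>
        D₀ ^ K < ∏ p ∈ d.primeFactors.filter (fun p : ℕ => (p : ℝ) ≤ D₀), (p : ℝ)).card : ℝ) ≤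
      ((2 : ℝ) ^ (K + 1))⁻¹ * ((2 * D : ℕ) * (1 + Real.log (2 * D : ℕ))) := by
  classical
  set E := (Finset.Icc D (2 * D)).filter fun d : ℕ =>
    D₀ ^ K < ∏ p ∈ d.primeFactors.filter (fun p : ℕ => (p : ℝ) ≤ D₀), (p : ℝ) with hE
  -- each exceptional `d` has `τ(d) ≥ 2^{K+1}`
  have htau : ∀ d ∈ E, (2 : ℝ) ^ (K + 1) ≤ (d.divisors.card : ℝ) := by
    intro d hd
    rw [hE, Finset.mem_filter] at hd
    obtain ⟨hdI, hprod⟩ := hd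
    have hd0 : d ≠ 0 := by
      rintro rfl
      simp at hprod
      linarith [one_le_pow₀ (M₀ := ℝ) hD₀ (n := K)]
    have hK := card_primeFactors_gt_of_prod_gt hD₀ hprod
    have hω : K + 1 ≤ d.primeFactors.card :=
      (Nat.succ_le_of_lt hK).trans (Finset.card_filter_le _ _)
    have h2 := two_pow_card_primeFactors_le_card_divisors hd0
    calc (2 : ℝ) ^ (K + 1) ≤ (2 : ℝ) ^ d.primeFactors.card := pow_le_pow_right₀ (by norm_num) hω
      _ ≤ d.divisors.card := by exact_mod_cast h2
  -- Markov
  have hsum : (E.card : ℝ) * (2 : ℝ) ^ (K + 1) ≤ ∑ d ∈ Finset.Icc 1 (2 * D), (d.divisors.card : ℝ) := by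
    calc (E.card : ℝ) * (2 : ℝ) ^ (K + 1) = ∑ d ∈ E, (2 : ℝ) ^ (K + 1) := by
          rw [Finset.sum_const, nsmul_eq_mul]
      _ ≤ ∑ d ∈ E, (d.divisors.card : ℝ) := Finset.sum_le_sum htau
      _ ≤ ∑ d ∈ Finset.Icc 1 (2 * D), (d.divisors.card : ℝ) := by
          refine Finset.sum_le_sum_of_subset_of_nonneg ?_ fun _ _ _ => Nat.cast_nonneg _
          intro d hd
          rw [hE, Finset.mem_filter, Finset.mem_Icc] at hd
          obtain ⟨⟨hdD, hd2D⟩, hprod⟩ := hd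
          have hd0 : d ≠ 0 := by
            rintro rfl
            simp at hprod
            linarith [one_le_pow₀ (M₀ := ℝ) hD₀ (n := K)]
          rw [Finset.mem_Icc]; omega
  have hpos : (0 : ℝ) < (2 : ℝ) ^ (K + 1) := by positivity
  rw [inv_mul_eq_div, le_div_iff₀ hpos]
  exact hsum.trans (sum_card_divisors_le' (2 * D))

end Polymath8a

end Literature.NumberTheory.Sieve
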